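import Literature.Computability.AlgebraicComplexity.MatMulNsmRankFiniteField
import Literature.Computability.AlgebraicComplexity.SubstitutionBacktracking
import Literature.Computability.AlgebraicComplexity.ConstrainedMatMulSandwich
import HarnessLib

/-!
# One substitution step along a rank class of first forms (Wang 2026, Lemma 1 + Lemma 3; Nazarov 2023, Lemmas 5–6)

Topic `Literature/Computability/AlgebraicComplexity` (bilinear complexity of matrix multiplication,
substitution method). PROVED theorems only, every field; no named facts, no new definitions.

A bilinear computation `XY = ∑_t f_t(X) g_t(Y) w_t` of `⟨c,m,n⟩` (`X ∈ k^{c×m}`, Bläser 2003 Def. 1,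
tree `BilinComp (mulBilin k c m n) ι`) has first forms `f_t(X) = ∑_{il} X_{il} (A_t)_{il}` with
coefficient matrices `A_t ∈ k^{c×m}` (tree `Nazarov2023.An`).  The group `GL_c × GL_m` acts on the
`A_t` by `A ↦ P A Q` through equivalent computations of the same length (Nazarov 2023, Lemma 6 =
tree `Nazarov2023.twistn`, `An_twistn`; Bläser 2003 §3 "sandwiching"), transitively on each rank
class (Nazarov 2023, Lemma 5, 1) = tree `exists_gl_mul_mul_gl_eq_of_rank_eq`), and restricting `X`
to a subspace `S` on which `f_t` vanishes discards the product `t` and leaves a computation of the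
constrained map `XY|_{S × k^{m×n}}` (Wang 2026, Lemma 3 = tree `BilinComp.restrictAlong`; the
constrained problem `T_S` of Wang 2026 §3.2 / Lemma 1 = tree `BilinComp ((mulBilin k c m n).comp S.subtype)`).
Put together (this file):

* `exists_constrained_of_rank_eq` — **transport-and-kill**: if some product `t` has `rank A_t = rank N`
  for a fixed matrix `N`, then for every subspace `S ⊆ {X : ∑ X_{il} N_{il} = 0}` there is a computation of
  `XY|_S` with `|ι| − 1` products;
* `succ_le_card_of_rank_eq` — the **`+1` rule along a rank class**: if every computation of `XY|_S`
  has `≥ b` products, every computation of `⟨c,m,n⟩` with a product in the rank class of `N` has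
  `≥ b + 1` products (Wang 2026, §2: "`R ≥ 1 +` [the bound after substitution]", here for ONE named
  class instead of all nonzero forms);
* `succ_le_card_of_rank_two` — the case `c = 2`, class representative `N = E₀₁ + E₁₀` (rank `2`),
  `S ⊆ {X : X₀₁ + X₁₀ = 0}`;
* `succ_le_tensorRank_of_rankClasses` — **the root recursion over EVERY field** (Wang 2026, §2: "`R(T) ≥ 1 +`
  min over the orbits `[a]` of nonzero first forms of `R(T|_{ker a})`", there over `𝔽_q` with the orbits
  enumerated; here the `GL_c × GL_m`-orbits of the nonzero first forms are the `min(c,m)` RANK CLASSES,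
  Nazarov 2023 Lemma 5, 1), so finitely many sub-problems suffice over any field): if for every rank
  `ρ ∈ [1, min(c,m)]` a matrix `N_ρ` of rank `ρ` and a constraint subspace `S_ρ ⊆ {X : ∑ X_{il} (N_ρ)_{il} = 0}`
  are given such that every computation of `XY|_{S_ρ}` has `≥ b` products, then `R(⟨c,m,n⟩) ≥ b + 1`
  (`c, m, n ≥ 1`; an optimal computation, tree `exists_bilinComp_of_tensorRank_le`, has a nonzero first
  form because `E₀₀ · E₀₀ ≠ 0`, and that form lies in one of the classes).

Use (cell pub-mm22, H-E3): with `k = 𝔽₂`, `⟨2,3,4⟩`, `S = {X₀₁ + X₁₀ = 0}` (Wang's orbit `[10]` of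
`⟨2,3,4⟩`) and `b = 19`, the last theorem is steps [β][γ] of the cell's E3 chain ("a 19-term computation
with a rank-two first form leaves an 18-term computation of `⟨2,3,4⟩|_S`"); step [α] (some product HAS a
rank-two first form, by the plane cap) and the assembled implication
"`⟨2,3,4⟩|_S` needs `≥ 19` over `𝔽₂` ⇒ `R_𝔽₂(⟨2,3,4⟩) ≥ 20`" live on the Summits side
(`Summits/MatrixMultiplication/OmegaCensus/SmallFormats/MatMul234Rank20OfCert10.lean`).

## References

* C. Wang, *Automated Lower Bounds for Bilinear Complexity over Finite Fields*, arXiv:2603.07280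
  (2026), §2 (worked example), §3.2 (constraint subspaces `T_S`), Lemma 1, Lemma 3. [Wang2026]
* A. A. Nazarov, Vestn. Mosk. Univ. Ser. 15 (2023) no. 4, 41–53, Lemma 5 (orbits of `GL_n × GL_s`
  on `F^{n×s}` are the rank classes), Lemma 6 (twisting a computation). [Nazarov2023FiniteFieldLB]
* M. Bläser, J. Complexity 19 (2003) 43–60, Def. 1, §3 (equivalent computations). [Blaser2003]
-/

namespace Literature.Computability.AlgebraicComplexity

open Module
open _root_.Matrix
open scoped _root_.Matrix

namespace RankClassSubstitution

variable {k : Type*} [Field k] {c m n : ℕ} {ι : Type*} [Fintype ι]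

variable [DecidableEq ι]

/-- **Transport-and-kill along a rank class** (Nazarov 2023, Lemmas 5–6: `GL_c × GL_m` moves `A_t` to
any matrix `N` of the same rank through an equivalent computation of the same length; Wang 2026,
Lemma 3: restricting `X` to a subspace on which the new first form `X ↦ ∑ X_{il} N_{il}` vanishes
discards that product): if some product `t` has `rank A_t = rank N`, then for every
`S ⊆ {X : ∑_{il} X_{il} N_{il} = 0}` the constrained map `XY|_{S × k^{m×n}}` (Wang's `T_S`) has a
computation with `|ι| − 1` products.
[cite: Wang2026, Lemma 1 and Lemma 3; Nazarov2023FiniteFieldLB, Lemmas 5–6] -/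
theorem exists_constrained_of_rank_eq (β : BilinComp (mulBilin k c m n) ι) (t : ι)
    (N : Matrix (Fin c) (Fin m) k) (hN : (Nazarov2023.An β t).rank = N.rank)
    (S : Submodule k (Matrix (Fin c) (Fin m) k)) (hS : ∀ x ∈ S, ∑ i, ∑ j, x i j * N i j = 0) :
    Nonempty (BilinComp ((mulBilin k c m n).comp S.subtype) (Fin (Fintype.card ι - 1))) := by
  obtain ⟨P, Q, hPQ⟩ :=
    Literature.LinearAlgebra.Matrix.exists_gl_mul_mul_gl_eq_of_rank_eq (Nazarov2023.An β t) N hN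
  -- transport: the twisted computation has `A'_t = P A_t Q = N`
  let β' := Nazarov2023.twistn β (P : Matrix (Fin c) (Fin c) k) (Q : Matrix (Fin m) (Fin m) k)
    (Matrix.isUnits_det_units P) (Matrix.isUnits_det_units Q)
  have hA' : Nazarov2023.An β' t = N := by
    rw [Nazarov2023.An_twistn]; exact hPQ
  have hf' : ∀ x ∈ S, β'.f t x = 0 := fun x hx => by
    rw [Nazarov2023.fn_eq_sum, hA']; exact hS x hx
  -- kill: restrict to `S` and discard the product `t`
  have hJ : ∀ i ∈ ({t} : Finset ι), ∀ u : S,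
      (β'.restrictSub S).f i (Submodule.inclusion le_rfl u) = 0 := by
    intro i hi u
    rw [Finset.mem_singleton.1 hi]
    simp only [BilinComp.restrictSub, BilinComp.comap_f, Submodule.subtype_apply,
      Submodule.coe_inclusion]
    exact hf' _ u.2
  have h := BilinComp.exists_restrictAlong (β'.restrictSub S) le_rfl {t} hJ
  rwa [Finset.card_singleton] at h

/-- **The `+1` rule along a rank class** (Wang 2026, §2 and Lemma 3, with Lemma 1 for the
transport): if every computation of `XY|_{S × k^{m×n}}` has at least `b` products, where
`S ⊆ {X : ∑ X_{il} N_{il} = 0}`, then every computation of `⟨c,m,n⟩` having a product whose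
coefficient matrix lies in the rank class of `N` has at least `b + 1` products.
[cite: Wang2026, §2, Lemma 1 and Lemma 3; Nazarov2023FiniteFieldLB, Lemmas 5–6] -/
theorem succ_le_card_of_rank_eq {b : ℕ} (S : Submodule k (Matrix (Fin c) (Fin m) k))
    (N : Matrix (Fin c) (Fin m) k) (hS : ∀ x ∈ S, ∑ i, ∑ j, x i j * N i j = 0)
    (hb : ∀ r, BilinComp ((mulBilin k c m n).comp S.subtype) (Fin r) → b ≤ r)
    (β : BilinComp (mulBilin k c m n) ι) (t : ι) (hN : (Nazarov2023.An β t).rank = N.rank) :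
    b + 1 ≤ Fintype.card ι := by
  obtain ⟨γ⟩ := exists_constrained_of_rank_eq β t N hN S hS
  have h1 := hb _ γ
  have h2 : 0 < Fintype.card ι := Fintype.card_pos_iff.2 ⟨t⟩
  omega

/-- The normal form `E₀₁ + E₁₀ ∈ k^{2×(m+2)}` of the rank-two class: rank `2`, and its form is
`X ↦ X₀₁ + X₁₀` (private plumbing). [folklore] -/
private theorem exists_normalForm_two (k : Type*) [Field k] (m : ℕ) :
    ∃ N : Matrix (Fin 2) (Fin (m + 2)) k, N.rank = 2 ∧
      ∀ x : Matrix (Fin 2) (Fin (m + 2)) k, ∑ i, ∑ j, x i j * N i j = x 0 1 + x 1 0 := by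
  classical
  let σ : Fin 2 → Fin (m + 2) := ![1, 0]
  have hσ0 : σ 0 = 1 := rfl
  have hσ1 : σ 1 = 0 := rfl
  have h10 : (1 : Fin (m + 2)) ≠ 0 := by simp
  let N : Matrix (Fin 2) (Fin (m + 2)) k := Matrix.of fun i j => if j = σ i then 1 else 0
  refine ⟨N, ?_, ?_⟩
  · apply le_antisymm (Matrix.rank_le_height N)
    have hNN : N * Nᵀ = 1 := by
      ext a b
      simp only [N, Matrix.mul_apply, Matrix.transpose_apply, Matrix.of_apply, ite_mul, one_mul,
        zero_mul, Finset.sum_ite_eq', Finset.mem_univ, if_true, Matrix.one_apply]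
      fin_cases a <;> fin_cases b <;> simp [hσ0, hσ1, h10, h10.symm]
    calc 2 = (1 : Matrix (Fin 2) (Fin 2) k).rank := by rw [Matrix.rank_one, Fintype.card_fin]
      _ = (N * Nᵀ).rank := by rw [hNN]
      _ ≤ N.rank := Matrix.rank_mul_le_left _ _
  · intro x
    simp only [N, Matrix.of_apply, mul_ite, mul_one, mul_zero, Finset.sum_ite_eq', Finset.mem_univ,
      if_true, Fin.sum_univ_two, hσ0, hσ1]

/-- **The rank-two class for `c = 2`** (format `⟨2, m+2, n⟩`; the class representative is
`E₀₁ + E₁₀`, whose form is `X ↦ X₀₁ + X₁₀` — over `𝔽₂` this is Wang's codimension-one orbit `[10]`):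
if every computation of `XY|_{S × k^{(m+2)×n}}` has `≥ b` products for some
`S ⊆ {X : X₀₁ + X₁₀ = 0}`, then every computation of `⟨2,m+2,n⟩` with a product whose coefficient
matrix has rank `2` has `≥ b + 1` products (transport that product to `E₀₁ + E₁₀`, kill it by the
constraint). [cite: Wang2026, Lemma 1 and Lemma 3; Nazarov2023FiniteFieldLB, Lemmas 5–6] -/
theorem succ_le_card_of_rank_two {b : ℕ} (S : Submodule k (Matrix (Fin 2) (Fin (m + 2)) k))
    (hS : ∀ x ∈ S, x 0 1 + x 1 0 = 0)
    (hb : ∀ r, BilinComp ((mulBilin k 2 (m + 2) n).comp S.subtype) (Fin r) → b ≤ r)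
    (β : BilinComp (mulBilin k 2 (m + 2) n) ι) (t : ι) (ht : (Nazarov2023.An β t).rank = 2) :
    b + 1 ≤ Fintype.card ι := by
  obtain ⟨N, hN2, hNf⟩ := exists_normalForm_two k m
  exact succ_le_card_of_rank_eq S N (fun x hx => by rw [hNf]; exact hS x hx) hb β t
    (ht.trans hN2.symm)

/-- A nonzero matrix over a field has positive rank (plumbing). [folklore] -/
private theorem rank_pos_of_ne_zero {A : Matrix (Fin c) (Fin m) k} (hA : A ≠ 0) : 0 < A.rank := by
  rw [Matrix.rank]
  by_contra h
  have h0 : Module.finrank k (LinearMap.range A.mulVecLin) = 0 := by omega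
  rw [Submodule.finrank_eq_zero, LinearMap.range_eq_bot] at h0
  apply hA
  apply Matrix.mulVec_injective
  funext v
  have := congrArg (fun f : (Fin m → k) →ₗ[k] (Fin c → k) => f v) h0
  simpa using this

/-- **Wang 2026 §2's root recursion, over every field** ("`R(T) ≥ 1 +` the bound after substitution",
minimised over the orbits of the nonzero first forms — over an arbitrary field `k` the
`GL_c × GL_m`-orbits of nonzero `c × m` matrices are the rank classes `1, …, min(c,m)`, Nazarov 2023,
Lemma 5, 1) = tree `exists_gl_mul_mul_gl_eq_of_rank_eq`): let `c, m, n ≥ 1`; suppose that for every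
rank `ρ` with `1 ≤ ρ ≤ min(c,m)` we are given a matrix `N ρ` of rank `ρ` and a subspace
`S ρ ⊆ {X : ∑_{il} X_{il} (N ρ)_{il} = 0}` such that every bilinear computation of the constrained map
`XY|_{S ρ × k^{m×n}}` (Wang's `T_{S_ρ}`) has at least `b` products. Then `R(⟨c,m,n⟩) ≥ b + 1`.
Proof: an optimal computation (`exists_bilinComp_of_tensorRank_le`, rank = bilinear complexity) has a
product `t` with `A_t ≠ 0` (else every first form vanishes and the computed map is `0`, but
`E₀₀ · E₀₀ = E₀₀ ≠ 0`); `A_t` has some rank `ρ ∈ [1, min(c,m)]`, and `succ_le_card_of_rank_eq` for that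
class gives `b + 1 ≤ R`.
[cite: Wang2026, §2, Lemma 1 and Lemma 3; Nazarov2023FiniteFieldLB, Lemmas 5–6] -/
theorem succ_le_tensorRank_of_rankClasses (hc : 0 < c) (hm : 0 < m) (hn : 0 < n) {b : ℕ}
    (N : ℕ → Matrix (Fin c) (Fin m) k) (S : ℕ → Submodule k (Matrix (Fin c) (Fin m) k))
    (hN : ∀ ρ, 1 ≤ ρ → ρ ≤ min c m → (N ρ).rank = ρ)
    (hS : ∀ ρ, 1 ≤ ρ → ρ ≤ min c m → ∀ x ∈ S ρ, ∑ i, ∑ j, x i j * N ρ i j = 0)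
    (hb : ∀ ρ, 1 ≤ ρ → ρ ≤ min c m →
      ∀ r, BilinComp ((mulBilin k c m n).comp (S ρ).subtype) (Fin r) → b ≤ r) :
    b + 1 ≤ tensorRank (matMulTensor k c m n) := by
  classical
  obtain ⟨β⟩ := exists_bilinComp_of_tensorRank_le (k := k) (c := c) (m := m) (n := n) le_rfl
  -- some product has a nonzero coefficient matrix: otherwise the computed map vanishes
  have hex : ∃ t, Nazarov2023.An β t ≠ 0 := by
    by_contra h
    simp only [not_exists, not_not] at h
    have hf : ∀ t x, β.f t x = 0 := fun t x => by
      rw [Nazarov2023.fn_eq_sum, h t]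
      simp
    have h1 := β.map_eq_sum (Matrix.single (⟨0, hc⟩ : Fin c) (⟨0, hm⟩ : Fin m) 1)
      (Matrix.single (⟨0, hm⟩ : Fin m) (⟨0, hn⟩ : Fin n) 1)
    simp only [hf, zero_mul, zero_smul, Finset.sum_const_zero, mulBilin_apply,
      Matrix.single_mul_single_same, mul_one] at h1
    have h2 := congrFun (congrFun h1 ⟨0, hc⟩) ⟨0, hn⟩
    simp at h2
  obtain ⟨t, ht⟩ := hex
  have hρ1 : 1 ≤ (Nazarov2023.An β t).rank := rank_pos_of_ne_zero ht
  have hρ2 : (Nazarov2023.An β t).rank ≤ min c m :=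
    le_min (Matrix.rank_le_height _) (Matrix.rank_le_width _)
  have h := succ_le_card_of_rank_eq (S _) (N _) (hS _ hρ1 hρ2) (hb _ hρ1 hρ2) β t
    (hN _ hρ1 hρ2).symm
  simpa using h

end RankClassSubstitution

end Literature.Computability.AlgebraicComplexity
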